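import Literature.Probability.RandomPlanarGeometry.SLETraceMarkov
import Literature.Probability.RandomPlanarGeometry.CritPercSLESwallowing
import Literature.Probability.RandomPlanarGeometry.LoewnerCotArgExit
import Literature.Analysis.Complex.KoebeDistortion
import HarnessLib

/-!
# The shifted trace near an interior point: Koebe and distortion (deterministic)

Topic `Probability/RandomPlanarGeometry`; theorems only. Deterministic Loewner geometry behind the
conditional one-point estimate "after a stopping time" (Beffara (2008), §3: apply the Markov property
at `T_ε(z)` and then the first-moment estimate in the slit domain; Cor. 5 = Prop. 4 transported by a
conformal map). For a chain of the continuous driving function `W` generated by `γ`, a time `s`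
such that the chain of the increments `u ↦ W(s+u) - W(s)` is generated by `γˢ` (the shifted trace;
`γ(s + u) = Fₛ(γˢ(u) + W(s))`, `IsGeneratedByCurve.apply_add_eq_extendFrom`), and a point `y` alive
at time `s` (`s < T_y`):

* `IsGeneratedByCurve.im_pos_and_map_extendFrom` — if `Fₛ(p) ∈ Hₛ` for `p ∈ ℍ̄` then `p ∈ ℍ` and
  `gₛ(Fₛ(p)) = p` (boundary points of `ℍ̄` go to `∂Hₛ`);
* `IsGeneratedByCurve.shift_eq_centredMap` — if `γ(s + u) ∈ Hₛ` then
  `γˢ(u) = gₛ(γ(s + u)) - W(s)`;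
* `norm_map_sub_map_le_of_le_koebe` — **Koebe + distortion**: with `ψ = ψₛ(y)` Rohde–Schramm's
  ratio and `ε ≤ Im y / (128 π ψ)`, every `w` with `|w - y| ≤ ε` lies in `Hₛ` and
  `|gₛ(w) - gₛ(y)| ≤ 4 ε |gₛ'(y)|` (`ball_subset_domain_of_ratio_le`, the tree's Koebe disc of
  radius `Im y/(64πψ)`, and `Literature.Analysis.Complex.AreaThm.distortion_ball` at `ρ ≤ 1/2`);
* `IsGeneratedByCurve.infDist_centredMap_shift_le` — hence if the curve after `s` comes within
  `ε ≤ Im y/(128πψ)` of `y`, the shifted trace `γˢ` comes within `4 ε |gₛ'(y)|` of the centred image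
  `zₛ = gₛ(y) - W(s)`.

## References

* V. Beffara, *The dimension of the SLE curves*, Ann. Probab. 36 (2008), Cor. 5 and §3.
* G. F. Lawler, *Conformally Invariant Processes in the Plane*, AMS (2005), §6.2, Thm. 3.21
  (distortion).
* Ch. Pommerenke, *Boundary Behaviour of Conformal Maps* (1992), Thm. 1.3.
-/

noncomputable section

open Set Filter Topology Metric Complex
open UpperHalfPlane (upperHalfPlaneSet isOpen_upperHalfPlaneSet)
open scoped NNReal Real

namespace Literature.Probability.RandomPlanarGeometry

namespace Loewner

variable {W : ℝ≥0 → ℝ} {γ γs : ℝ≥0 → ℂ} {s : ℝ≥0}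

/-- **Interior values of the extension come from interior points.** If the chain of `W` is
generated by a curve, `p ∈ ℍ̄` and `Fₛ(p) ∈ Hₛ` (`Fₛ` the continuous extension of `fₛ = gₛ⁻¹`), then
`Im p > 0` and `gₛ(Fₛ(p)) = p`: approach `p` by `p + i/(n+1)`, where `Fₛ = fₛ` and `gₛ ∘ fₛ = id`,
and use the continuity of `Fₛ` on `ℍ̄` and of `gₛ` on the open set `Hₛ`. [folklore] -/
theorem IsGeneratedByCurve.im_pos_and_map_extendFrom (hγ : IsGeneratedByCurve W γ) (hW : Continuous W)
    (s : ℝ≥0) {p : ℂ} (hp : p ∈ closure upperHalfPlaneSet)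
    (hF : extendFrom upperHalfPlaneSet (loewnerInv W s) p ∈ domain W s) :
    0 < p.im ∧ map W s (extendFrom upperHalfPlaneSet (loewnerInv W s) p) = p := by
  set F := extendFrom upperHalfPlaneSet (loewnerInv W s) with hFdef
  set q : ℕ → ℂ := fun n ↦ p + I * ((1 : ℝ) / (n + 1) : ℝ) with hq
  have hp0 : 0 ≤ p.im := mem_closure_upperHalfPlaneSet_iff.1 hp
  have hqim : ∀ n, 0 < (q n).im := fun n ↦ by
    simp only [hq, Complex.add_im, Complex.mul_im, Complex.I_re, Complex.I_im, Complex.ofReal_re,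
      Complex.ofReal_im, zero_mul, one_mul, zero_add]
    positivity
  have hqH : ∀ n, q n ∈ upperHalfPlaneSet := hqim
  -- `q n → p`
  have hqt : Tendsto q atTop (𝓝 p) := by
    have h1 : Tendsto (fun n : ℕ ↦ ((1 : ℝ) / (n + 1) : ℝ)) atTop (𝓝 0) := tendsto_one_div_add_atTop_nhds_zero_nat
    have h2 : Tendsto (fun n : ℕ ↦ (((1 : ℝ) / (n + 1) : ℝ) : ℂ)) atTop (𝓝 ((0 : ℝ) : ℂ)) :=
      (Complex.continuous_ofReal.tendsto 0).comp h1
    have h3 := (h2.const_mul I).const_add p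
    simpa [hq] using h3
  -- `F (q n) → F p`
  have hFc : ContinuousWithinAt F (closure upperHalfPlaneSet) p :=
    hγ.continuousOn_extendFrom_loewnerInv hW s p hp
  have hFt : Tendsto (fun n ↦ F (q n)) atTop (𝓝 (F p)) :=
    hFc.tendsto.comp (tendsto_nhdsWithin_iff.2 ⟨hqt, Eventually.of_forall fun n ↦ subset_closure (hqH n)⟩)
  -- `g (F (q n)) = q n`
  have hgF : ∀ n, map W s (F (q n)) = q n := fun n ↦ by
    rw [hFdef, extendFrom_loewnerInv_eq hW s (hqim n), map_loewnerInv hW s (hqim n)]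
  -- continuity of `g` at `F p ∈ H_s`
  have hgc : ContinuousAt (map W s) (F p) :=
    ((differentiableOn_map hW s).continuousOn.continuousWithinAt hF).continuousAt
      ((isOpen_domain hW s).mem_nhds hF)
  have hlim : Tendsto (fun n ↦ map W s (F (q n))) atTop (𝓝 (map W s (F p))) := hgc.tendsto.comp hFt
  have heq : map W s (F p) = p := tendsto_nhds_unique hlim (by simpa only [hgF] using hqt)
  refine ⟨?_, heq⟩
  have := mapsTo_map hW s hF
  rw [heq] at this
  exact this

/-- **The shifted trace in the centred coordinates**: if `γ(s + u) ∈ Hₛ` then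
`γˢ(u) = gₛ(γ(s + u)) - W(s)` (and `γˢ(u) + W(s) ∈ ℍ`). [cite: Lawler2005, §6.2] -/
theorem IsGeneratedByCurve.shift_eq_centredMap (hγ : IsGeneratedByCurve W γ) (hW : Continuous W)
    (hγs : IsGeneratedByCurve (fun u ↦ W (s + u) - W s) γs) {u : ℝ≥0} (hu : γ (s + u) ∈ domain W s) :
    γs u = centredMap W s (γ (s + u)) ∧ 0 < (γs u + W s).im := by
  have hp : γs u + (W s : ℂ) ∈ closure upperHalfPlaneSet := by
    rw [mem_closure_upperHalfPlaneSet_iff]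
    simp only [Complex.add_im, Complex.ofReal_im, add_zero]
    exact hγs.2.2.1 u
  have happ := hγ.apply_add_eq_extendFrom hW hγs u
  have h := hγ.im_pos_and_map_extendFrom hW s hp (by rw [← happ]; exact hu)
  refine ⟨?_, h.1⟩
  have hmap : map W s (γ (s + u)) = γs u + W s := by rw [happ]; exact h.2
  rw [centredMap_apply, hmap, add_sub_cancel_right]

/-- **Koebe and distortion at an alive point.** Let `y ∈ ℍ` be alive at time `s` (`s < T_y`),
`ψ = ψₛ(y) = Im y |gₛ'(y)| / Im gₛ(y)` and `0 < ε ≤ Im y/(128 π ψ)`. Then every `w` with `|w - y| ≤ ε`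
lies in `Hₛ` and `|gₛ(w) - gₛ(y)| ≤ 4 ε |gₛ'(y)|`: the disc of radius `R = Im y/(64πψ)` about `y` lies
in `Hₛ` (`ball_subset_domain_of_ratio_le`), `gₛ` is univalent there, and Koebe's distortion
`|g(w) - g(y)| ≤ |g'(y)| R ρ/(1-ρ)²`, `ρ = |w-y|/R ≤ 1/2`. [cite: PommerenkeBBCM1992, Thm. 1.3] -/
theorem norm_map_sub_map_le_of_le_koebe (hW : Continuous W) {y : ℂ} (hy : 0 < y.im) {s : ℝ≥0}
    (hs : (s : WithTop ℝ≥0) < swallowingTime W y) {ε : ℝ} (hε : 0 < ε)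
    (hεK : ε ≤ y.im / (128 * π * derivRatio W y s)) {w : ℂ} (hw : ‖w - y‖ ≤ ε) :
    w ∈ domain W s ∧ ‖map W s w - map W s y‖ ≤ 4 * ε * ‖deriv (map W s) y‖ := by
  set ψ := derivRatio W y s with hψ
  have hψ1 : 1 ≤ ψ := one_le_derivRatio hW hy hs
  have hψ0 : 0 < ψ := one_pos.trans_le hψ1
  set R : ℝ := y.im / (64 * π * ψ) with hR
  have hR0 : 0 < R := by positivity
  have hεR : ε ≤ R / 2 := by
    rw [hR]; rw [show y.im / (128 * π * ψ) = y.im / (64 * π * ψ) / 2 by field_simp; ring] at hεK; exact hεK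
  have hball : ball y R ⊆ domain W s :=
    ball_subset_domain_of_ratio_le hW hy hs (M := ψ) (by rw [hψ, derivRatio_apply])
  have hwb : w ∈ ball y R := by
    rw [mem_ball, dist_eq_norm]; linarith
  refine ⟨hball hwb, ?_⟩
  have hdiff : DifferentiableOn ℂ (map W s) (ball y R) := (differentiableOn_map hW s).mono hball
  have hinj : InjOn (map W s) (ball y R) := (injOn_map hW s).mono hball
  obtain ⟨-, -, h3⟩ := Literature.Analysis.Complex.AreaThm.distortion_ball hR0 hdiff hinj hwb
  set ρ : ℝ := ‖w - y‖ / R with hρ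
  have hρ0 : 0 ≤ ρ := by positivity
  have hρ2 : ρ ≤ 1 / 2 := by rw [hρ, div_le_iff₀ hR0]; linarith
  have h1ρ : (1 : ℝ) / 2 ≤ 1 - ρ := by linarith
  have hsq : (1 : ℝ) / 4 ≤ (1 - ρ) ^ 2 := by nlinarith
  have hq : ρ / (1 - ρ) ^ 2 ≤ 4 * ρ := by
    rw [div_le_iff₀ (by positivity)]
    have := mul_le_mul_of_nonneg_left hsq (by positivity : (0 : ℝ) ≤ 4 * ρ)
    linarith
  calc ‖map W s w - map W s y‖ ≤ ‖deriv (map W s) y‖ * R * (ρ / (1 - ρ) ^ 2) := h3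
    _ ≤ ‖deriv (map W s) y‖ * R * (4 * ρ) := by gcongr
    _ = 4 * ‖w - y‖ * ‖deriv (map W s) y‖ := by rw [hρ]; field_simp
    _ ≤ 4 * ε * ‖deriv (map W s) y‖ := by gcongr

/-- **If the curve after `s` comes `ε`-close to an alive point `y` (`ε ≤ Im y/(128πψₛ(y))`), the
shifted trace comes `4ε|gₛ'(y)|`-close to the centred image `zₛ = gₛ(y) - W(s)`.**
(`shift_eq_centredMap` and `norm_map_sub_map_le_of_le_koebe`.) The deterministic core of the
conditional one-point estimate after a stopping time (Beffara (2008), §3 / Cor. 5). [folklore] -/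
theorem IsGeneratedByCurve.infDist_centredMap_shift_le (hγ : IsGeneratedByCurve W γ) (hW : Continuous W)
    (hγs : IsGeneratedByCurve (fun u ↦ W (s + u) - W s) γs) {y : ℂ} (hy : 0 < y.im)
    (hs : (s : WithTop ℝ≥0) < swallowingTime W y) {ε : ℝ} (hε : 0 < ε)
    (hεK : ε ≤ y.im / (128 * π * derivRatio W y s)) {u : ℝ≥0} (hu : ‖γ (s + u) - y‖ ≤ ε) :
    ‖γs u - centredMap W s y‖ ≤ 4 * ε * ‖deriv (map W s) y‖ ∧
      infDist (centredMap W s y) (range γs) ≤ 4 * ε * ‖deriv (map W s) y‖ := by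
  obtain ⟨hdom, hdist⟩ := norm_map_sub_map_le_of_le_koebe hW hy hs hε hεK hu
  obtain ⟨heq, -⟩ := hγ.shift_eq_centredMap hW hγs hdom
  have h1 : ‖γs u - centredMap W s y‖ ≤ 4 * ε * ‖deriv (map W s) y‖ := by
    rw [heq, centredMap_apply, centredMap_apply, sub_sub_sub_cancel_right]
    exact hdist
  refine ⟨h1, ?_⟩
  calc infDist (centredMap W s y) (range γs) ≤ dist (centredMap W s y) (γs u) :=
        infDist_le_dist_of_mem (mem_range_self u)
    _ = ‖γs u - centredMap W s y‖ := by rw [dist_comm, dist_eq_norm]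
    _ ≤ 4 * ε * ‖deriv (map W s) y‖ := h1

end Loewner

end Literature.Probability.RandomPlanarGeometry
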